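import Mathlib
import Literature.NumberTheory.Transcendental.RoyCriterion
import Literature.NumberTheory.Transcendental.RoyCriterionProofs
import Summits.Schanuel.Schanuel.Theorems.SoloBlindRoyDCongruence
import HarnessLib

/-!
# Padé-type vanishing forces divisibility of ALL Taylor coefficients

For `P ∈ ℤ[X₀,X₁]` the integers `taylorInt n P = (DⁿP)(0,1) = n!·[zⁿ] P(z,e^z)`
(`Literature…taylorInt`; `D = ∂₀ + X₁∂₁ = royD`) satisfy, for every prime `p`:

* `D^{pk} ≡ E^k (mod p)` with `E = X₁∂₁` (`C_dvd_iterate_royD_mul_sub`, from the operator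
  congruence `D^p ≡ E` of `SoloBlindRoyDCongruence` and `DE = ED`), and `E^p ≡ E (mod p)`
  (Fermat); hence `n ↦ taylorInt n P (mod p)` is PERIODIC with period `p(p-1)` from `n ≥ p`
  on (`dvd_taylorInt_add_sub`);
* consequently, if `taylorInt m P = 0` for all `m < p²` (the pre-period and one full period),
  then `p ∣ taylorInt n P` for EVERY `n` (`dvd_taylorInt_of_eq_zero`).

For the Padé-type forms of the solo normal form (W″) — `taylorInt n P_N = 0` for `n ≤ N^v` —
this gives `p ∣ taylorInt n P_N` for all `n` and all primes `p` with `p² ≤ N^v`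
(`eventually_dvd_taylorInt_of_pade`): every Taylor coefficient of Roy's auxiliary function is
divisible by the primorial of `N^{v/2}`.  Equivalently `P_N mod p` lies in the kernel of the
Hurwitz–Taylor map `P̄ ↦ P̄(z, e^z) ∈ 𝔽_p⟨z⟩` (divided powers: `z^p = 0`, `(e^z)^p = 1` there),
an ideal containing the ideal `(X₀^p, X₁^p − 1)` of the Frobenius kernel
`α_p × μ_p ⊂ 𝔾_a × 𝔾_m` — the characteristic-`p` shadow of the graph of `exp` — and of
codimension `≤ p²` (equal to it in every computed case; not proved here).  Recorded in the solo
wall (R-A8, addendum) with the accounting showing that it carries no leverage against the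
elimination floor. [this work; elementary]
-/

noncomputable section

open MvPolynomial Finset

namespace Summit.Schanuel.Schanuel.Theorems

open Literature.NumberTheory.Transcendental

/-- `royD^[n]` respects subtraction. [folklore] -/
theorem iterate_royD_sub' (n : ℕ) (A B : MvPolynomial (Fin 2) ℤ) :
    royD^[n] (A - B) = royD^[n] A - royD^[n] B := by
  induction n generalizing A B with
  | zero => rfl
  | succ n ih =>
    have h1 : royD (A - B) = royD A - royD B := by
      simp only [royD, map_sub, mul_sub]
      ring
    rw [Function.iterate_succ_apply, h1, ih, Function.iterate_succ_apply, Function.iterate_succ_apply]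

/-- `C p ∣ Q` is preserved by `royD^[n]`. [folklore] -/
theorem C_dvd_iterate_royD_of_dvd (n : ℕ) {c : ℤ} {Q : MvPolynomial (Fin 2) ℤ}
    (h : (C c : MvPolynomial (Fin 2) ℤ) ∣ Q) : (C c : MvPolynomial (Fin 2) ℤ) ∣ royD^[n] Q := by
  obtain ⟨W, rfl⟩ := h
  rw [iterate_royD_C_mul]
  exact dvd_mul_right _ _

/-- `C c ∣ Q` is preserved by `E = X₁∂₁`. [folklore] -/
theorem C_dvd_X_one_mul_pderiv_one_of_dvd {c : ℤ} {Q : MvPolynomial (Fin 2) ℤ}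
    (h : (C c : MvPolynomial (Fin 2) ℤ) ∣ Q) :
    (C c : MvPolynomial (Fin 2) ℤ) ∣ X 1 * pderiv 1 Q := by
  obtain ⟨W, rfl⟩ := h
  rw [pderiv_C_mul]
  exact Dvd.intro (X 1 * pderiv 1 W) (by ring)

/-- `E^[n]` is additive. [folklore] -/
theorem iterate_X_one_mul_pderiv_one_add (n : ℕ) (A B : MvPolynomial (Fin 2) ℤ) :
    (fun R : MvPolynomial (Fin 2) ℤ => X 1 * pderiv 1 R)^[n] (A + B) =
      (fun R : MvPolynomial (Fin 2) ℤ => X 1 * pderiv 1 R)^[n] A +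
        (fun R : MvPolynomial (Fin 2) ℤ => X 1 * pderiv 1 R)^[n] B := by
  induction n generalizing A B with
  | zero => rfl
  | succ n ih =>
    rw [Function.iterate_succ_apply, Function.iterate_succ_apply, Function.iterate_succ_apply, ← ih,
      map_add, mul_add]

/-- **Fermat for `E = X₁∂₁`:** `C p ∣ E^p Q − E Q`. [folklore] -/
theorem C_dvd_iterate_X_one_mul_pderiv_one_sub {p : ℕ} (hp : p.Prime) (Q : MvPolynomial (Fin 2) ℤ) :
    (C (p : ℤ) : MvPolynomial (Fin 2) ℤ) ∣
      (fun R : MvPolynomial (Fin 2) ℤ => X 1 * pderiv 1 R)^[p] Q - X 1 * pderiv 1 Q := by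
  haveI := Fact.mk hp
  induction Q using MvPolynomial.induction_on' with
  | monomial s c =>
    rw [iterate_X_one_mul_pderiv_one_monomial, X_one_mul_pderiv_one_monomial, ← map_sub]
    obtain ⟨q, hq⟩ : (p : ℤ) ∣ ((s 1 : ℕ) : ℤ) ^ p - ((s 1 : ℕ) : ℤ) := by
      refine (ZMod.intCast_zmod_eq_zero_iff_dvd _ p).mp ?_
      push_cast
      rw [ZMod.pow_card, sub_self]
    refine ⟨monomial s (c * q), ?_⟩
    rw [C_mul_monomial, ← mul_sub, hq]
    congr 1
    ring
  | add Q R hQ hR =>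
    rw [iterate_X_one_mul_pderiv_one_add, map_add, mul_add]
    have e : (fun R : MvPolynomial (Fin 2) ℤ => X 1 * pderiv 1 R)^[p] Q +
          (fun R : MvPolynomial (Fin 2) ℤ => X 1 * pderiv 1 R)^[p] R -
          (X 1 * pderiv 1 Q + X 1 * pderiv 1 R) =
        ((fun R : MvPolynomial (Fin 2) ℤ => X 1 * pderiv 1 R)^[p] Q - X 1 * pderiv 1 Q) +
          ((fun R : MvPolynomial (Fin 2) ℤ => X 1 * pderiv 1 R)^[p] R - X 1 * pderiv 1 R) := by
      ring
    rw [e]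
    exact dvd_add hQ hR

/-- `D` and `E = X₁∂₁` commute. [folklore] -/
theorem royD_X_one_mul_pderiv_one (Q : MvPolynomial (Fin 2) ℤ) :
    royD (X 1 * pderiv 1 Q) = X 1 * pderiv 1 (royD Q) := by
  simp only [royD]
  rw [pderiv_zero_X_one_mul_pderiv_one, map_add, mul_add]

/-- `Dⁿ` and `E = X₁∂₁` commute. [folklore] -/
theorem iterate_royD_X_one_mul_pderiv_one (n : ℕ) (Q : MvPolynomial (Fin 2) ℤ) :
    royD^[n] (X 1 * pderiv 1 Q) = X 1 * pderiv 1 (royD^[n] Q) := by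
  induction n generalizing Q with
  | zero => rfl
  | succ n ih => rw [Function.iterate_succ_apply, royD_X_one_mul_pderiv_one, ih,
      Function.iterate_succ_apply]

/-- **`D^{pk} ≡ E^k (mod p)`.** [this work] -/
theorem C_dvd_iterate_royD_mul_sub {p : ℕ} (hp : p.Prime) (k : ℕ) (Q : MvPolynomial (Fin 2) ℤ) :
    (C (p : ℤ) : MvPolynomial (Fin 2) ℤ) ∣
      royD^[p * k] Q - (fun R : MvPolynomial (Fin 2) ℤ => X 1 * pderiv 1 R)^[k] Q := by
  induction k with
  | zero => simp
  | succ k ih =>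
    rw [show p * (k + 1) = p + p * k by ring, Function.iterate_add_apply,
      Function.iterate_succ_apply']
    have h1 := C_dvd_iterate_royD_sub hp (royD^[p * k] Q)
    have h2 : (C (p : ℤ) : MvPolynomial (Fin 2) ℤ) ∣ X 1 * pderiv 1 (royD^[p * k] Q) -
        X 1 * pderiv 1 ((fun R : MvPolynomial (Fin 2) ℤ => X 1 * pderiv 1 R)^[k] Q) := by
      rw [← mul_sub, ← map_sub]
      exact C_dvd_X_one_mul_pderiv_one_of_dvd ih
    have := dvd_add h1 h2
    convert this using 1
    ring

/-- **Periodicity of the Taylor coefficients mod `p`.**  For `n ≥ p`: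
`taylorInt (n + p(p−1)) P ≡ taylorInt n P (mod p)`. [this work] -/
theorem dvd_taylorInt_add_sub {p : ℕ} (hp : p.Prime) (P : MvPolynomial (Fin 2) ℤ) {n : ℕ}
    (hn : p ≤ n) : (p : ℤ) ∣ taylorInt (n + p * (p - 1)) P - taylorInt n P := by
  have hq : p ≤ p * p := Nat.le_mul_self p
  have hmul : p * (p - 1) = p * p - p := Nat.mul_sub_one p p
  have e1 : n + p * (p - 1) = (n - p) + p * p := by omega
  have e2 : n = (n - p) + p := by omega
  have key : (C (p : ℤ) : MvPolynomial (Fin 2) ℤ) ∣ royD^[p * p] P - royD^[p] P := by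
    have hA := C_dvd_iterate_royD_mul_sub hp p P
    have hB := C_dvd_iterate_X_one_mul_pderiv_one_sub hp P
    have hC := C_dvd_iterate_royD_sub hp P
    have := (dvd_add hA hB).sub hC
    convert this using 1
    ring
  have key' : (C (p : ℤ) : MvPolynomial (Fin 2) ℤ) ∣
      royD^[n + p * (p - 1)] P - royD^[n] P := by
    rw [e1, Function.iterate_add_apply,
      show royD^[n] P = royD^[n - p] (royD^[p] P) by rw [← Function.iterate_add_apply, ← e2],
      ← iterate_royD_sub']
    exact C_dvd_iterate_royD_of_dvd _ key
  have := map_dvd (eval ![(0 : ℤ), 1]) key'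
  rwa [eval_C, map_sub] at this

/-- **Padé-type vanishing of order `p²` forces `p ∣` every Taylor coefficient.**  If
`taylorInt m P = 0` for all `m < p²` then `p ∣ taylorInt n P` for all `n`: the pre-period is `< p`
and one full period `p(p−1)` fits below `p²`. Equivalently `P mod p` lies in the kernel of the
Hurwitz–Taylor map `P̄ ↦ P̄(z, e^z) ∈ 𝔽_p⟨z⟩` (an ideal containing the Frobenius-kernel ideal
`(X₀^p, X₁^p − 1)`). [this work] -/
theorem dvd_taylorInt_of_eq_zero {p : ℕ} (hp : p.Prime) (P : MvPolynomial (Fin 2) ℤ)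
    (h : ∀ m < p ^ 2, taylorInt m P = 0) (n : ℕ) : (p : ℤ) ∣ taylorInt n P := by
  induction n using Nat.strong_induction_on with
  | _ n ih =>
    by_cases hn : n < p ^ 2
    · rw [h n hn]; exact dvd_zero _
    · have hn : p ^ 2 ≤ n := not_lt.mp hn
      have hq : p ^ 2 = p + p * (p - 1) := by
        rw [sq, Nat.mul_sub_one]; have := Nat.le_mul_self p; omega
      have hpos : 0 < p * (p - 1) := Nat.mul_pos hp.pos (by have := hp.two_le; omega)
      set n' := n - p * (p - 1) with hn'
      have hn'p : p ≤ n' := by omega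
      have hnn' : n = n' + p * (p - 1) := by omega
      have hlt : n' < n := by omega
      have hper := dvd_taylorInt_add_sub hp P hn'p
      rw [← hnn'] at hper
      have := dvd_add hper (ih n' hlt)
      rwa [sub_add_cancel] at this

/-- **Frobenius-kernel shadow of Padé-type forms (solo wall R-A8, addendum).**  If eventually
`taylorInt n P_N = 0` for all `n ≤ N^v`, then eventually, for every prime `p` with `p² ≤ N^v`, EVERY
Taylor coefficient `taylorInt n P_N` (`n ∈ ℕ`) is divisible by `p` — hence by the primorial of
`⌊N^{v/2}⌋`.  (Such sequences, with `deg ≤ (N^{t₀}, N^{t₁})`, height `≤ e^N` and any `v` in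
`(u, (1+t₀+t₁)/2)`, exist for every Roy-admissible window: the Padé normal form of Roy's hypothesis
for `exp`.) [this work] -/
theorem eventually_dvd_taylorInt_of_pade {v : ℝ} (P : ℕ → MvPolynomial (Fin 2) ℤ)
    (hP : ∀ᶠ N : ℕ in Filter.atTop, ∀ n : ℕ, (n : ℝ) ≤ (N : ℝ) ^ v → taylorInt n (P N) = 0) :
    ∀ᶠ N : ℕ in Filter.atTop, ∀ p : ℕ, p.Prime → ((p : ℝ) ^ 2 ≤ (N : ℝ) ^ v) →
      ∀ n : ℕ, (p : ℤ) ∣ taylorInt n (P N) := by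
  filter_upwards [hP] with N hN p hp hpN n
  refine dvd_taylorInt_of_eq_zero hp (P N) (fun m hm => hN m ?_) n
  have : (m : ℝ) < (p : ℝ) ^ 2 := by exact_mod_cast hm
  exact this.le.trans hpN

end Summit.Schanuel.Schanuel.Theorems

end
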